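import Mathlib
import HarnessLib

/-!
# Eigenvector coordinates of a Hermitian matrix: rank-one expansion and Jordan splitting

Standard finite-dimensional spectral bookkeeping over `ℂ`, in COORDINATES (plain functions `N → ℂ`, `dotProduct`,
`star`), on top of Mathlib's `Matrix.IsHermitian.eigenvectorBasis` / `eigenvalues` / `mulVec_eigenvectorBasis`:
* orthonormality and completeness of the eigenvector basis in coordinates (`eigvec_orthonormal`, `eigvec_expand`);
* the RANK-ONE EXPANSION `A x y = Σ_i λ_i φ_i(x) conj(φ_i(y))` (`hermitian_apply_eq_sum_eigen`) and the quadratic form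
  `⟨w, A w⟩ = Σ_i λ_i |⟨φ_i, w⟩|²` (`hermitian_quadform_eq_sum`, `psd_eigen_term_le`);
* the JORDAN SPLITTING of a Hermitian matrix into positive and negative spectral parts, `H = Y − Z`, `Y, Z ⪰ 0`,
  `tr Y + tr Z = Σ_i |λ_i| = Re Σ_i ε_i ⟨φ_i, H φ_i⟩` (`hermitian_exists_jordan`, `hermitian_sum_abs_eigenvalues_eq`).
All of this is textbook matrix analysis (R. Bhatia, *Matrix Analysis*, GTM 169, §I.2–I.4; R. A. Horn and C. R. Johnson,
*Matrix Analysis*, 2nd ed., §2.5 and §4.1); Mathlib has the spectral theorem but not these coordinate forms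
(`lean search 'eigenvectorBasis.*conj|posPart.*trace'`).  Written for the matrix-multiplication programme
(line `frame-negativity-singlet-fraction` of crux `DiagonalPowerDecay`), usable anywhere.
-/

noncomputable section

open scoped BigOperators ComplexConjugate ComplexOrder
open _root_.Matrix

namespace Literature.LinearAlgebra.Matrix

section Bridge

variable {N : Type*} [Fintype N] [DecidableEq N]

/-- Orthonormality of the eigenvector basis of a Hermitian matrix, in coordinates:
`Σ_x conj(φ_i x) φ_j x = δ_ij`. [folklore] -/
theorem eigvec_orthonormal {A : Matrix N N ℂ} (hA : A.IsHermitian) (i j : N) :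
    (∑ x, conj ((hA.eigenvectorBasis i) x) * (hA.eigenvectorBasis j) x) = if i = j then 1 else 0 := by
  have h := orthonormal_iff_ite.mp hA.eigenvectorBasis.orthonormal i j
  rw [EuclideanSpace.inner_eq_star_dotProduct] at h
  rw [← h, dotProduct]
  refine Finset.sum_congr rfl fun x _ => ?_
  rw [Pi.star_apply, RCLike.star_def, mul_comm]

/-- Unit norm of the eigenvectors, in coordinates: `Σ_x ‖φ_i x‖² = 1`. [folklore] -/
theorem eigvec_normSq {A : Matrix N N ℂ} (hA : A.IsHermitian) (i : N) :
    (∑ x, ‖(hA.eigenvectorBasis i) x‖ ^ 2) = 1 := by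
  have h := eigvec_orthonormal hA i i
  rw [if_pos rfl] at h
  have h' : (∑ x, (((‖(hA.eigenvectorBasis i) x‖ ^ 2 : ℝ)) : ℂ)) = 1 := by
    rw [← h]
    refine Finset.sum_congr rfl fun x _ => ?_
    rw [mul_comm, Complex.mul_conj, Complex.normSq_eq_norm_sq]
  exact_mod_cast h'

/-- Completeness of the eigenvector basis, in coordinates: `w = Σ_i ⟨φ_i, w⟩ φ_i`. [folklore] -/
theorem eigvec_expand {A : Matrix N N ℂ} (hA : A.IsHermitian) (w : N → ℂ) :
    w = ∑ i, (∑ x, conj ((hA.eigenvectorBasis i) x) * w x) • ⇑(hA.eigenvectorBasis i) := by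
  have h := hA.eigenvectorBasis.sum_repr' (WithLp.toLp 2 w)
  have h2 := congrArg WithLp.ofLp h
  simp only [WithLp.ofLp_sum, WithLp.ofLp_smul] at h2
  have hc : ∀ i, inner ℂ (hA.eigenvectorBasis i) (WithLp.toLp 2 w) =
      ∑ x, conj ((hA.eigenvectorBasis i) x) * w x := by
    intro i
    rw [EuclideanSpace.inner_eq_star_dotProduct, dotProduct]
    refine Finset.sum_congr rfl fun x _ => ?_
    rw [Pi.star_apply, RCLike.star_def, mul_comm]
  calc w = ∑ i, inner ℂ (hA.eigenvectorBasis i) (WithLp.toLp 2 w) • ⇑(hA.eigenvectorBasis i) := h2.symm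
    _ = ∑ i, (∑ x, conj ((hA.eigenvectorBasis i) x) * w x) • ⇑(hA.eigenvectorBasis i) :=
        Finset.sum_congr rfl fun i _ => by rw [hc i]

/-- **Rank-one expansion** of a Hermitian matrix along its eigenvector basis:
`A x y = Σ_i λ_i φ_i(x) conj(φ_i(y))`. [folklore] -/
theorem hermitian_apply_eq_sum_eigen {A : Matrix N N ℂ} (hA : A.IsHermitian) (x y : N) :
    A x y = ∑ i, (hA.eigenvalues i : ℂ) * (hA.eigenvectorBasis i) x * conj ((hA.eigenvectorBasis i) y) := by
  have h1 : A x y = (A *ᵥ (Pi.single y 1 : N → ℂ)) x := by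
    rw [Matrix.mulVec_single_one]; rfl
  have hexp := eigvec_expand hA (Pi.single y 1 : N → ℂ)
  have hcoef : ∀ i, (∑ x', conj ((hA.eigenvectorBasis i) x') * (Pi.single y 1 : N → ℂ) x') =
      conj ((hA.eigenvectorBasis i) y) := by
    intro i
    rw [Finset.sum_eq_single y]
    · simp
    · intro x' _ hx'; simp [Pi.single_eq_of_ne hx']
    · intro h; exact absurd (Finset.mem_univ _) h
  simp_rw [hcoef] at hexp
  rw [h1, hexp, Matrix.mulVec_sum]
  simp only [Finset.sum_apply]
  refine Finset.sum_congr rfl fun i _ => ?_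
  rw [Matrix.mulVec_smul, hA.mulVec_eigenvectorBasis i, Pi.smul_apply, Pi.smul_apply, smul_eq_mul,
    Complex.real_smul]
  ring

/-- The quadratic form of a Hermitian matrix along its eigenvector basis:
`⟨w, A w⟩ = Σ_i λ_i |⟨φ_i, w⟩|²`. [folklore] -/
theorem hermitian_quadform_eq_sum {A : Matrix N N ℂ} (hA : A.IsHermitian) (w : N → ℂ) :
    star w ⬝ᵥ (A *ᵥ w) =
      ∑ i, (hA.eigenvalues i : ℂ) * (((‖∑ x, conj ((hA.eigenvectorBasis i) x) * w x‖ ^ 2 : ℝ)) : ℂ) := by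
  have hsq : ∀ z : ℂ, (((‖z‖ ^ 2 : ℝ)) : ℂ) = z * conj z := fun z => by
    rw [Complex.mul_conj, Complex.normSq_eq_norm_sq]
  calc star w ⬝ᵥ (A *ᵥ w) = ∑ x, ∑ y, conj (w x) * (A x y * w y) := by
        simp only [dotProduct, Matrix.mulVec, Pi.star_apply, RCLike.star_def, Finset.mul_sum]
    _ = ∑ x, ∑ y, ∑ i, (hA.eigenvalues i : ℂ) *
          ((conj ((hA.eigenvectorBasis i) y) * w y) * conj (conj ((hA.eigenvectorBasis i) x) * w x)) := by
        refine Finset.sum_congr rfl fun x _ => Finset.sum_congr rfl fun y _ => ?_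
        rw [hermitian_apply_eq_sum_eigen hA x y, Finset.sum_mul, Finset.mul_sum]
        refine Finset.sum_congr rfl fun i _ => ?_
        simp only [map_mul, Complex.conj_conj]
        ring
    _ = ∑ x, ∑ i, ∑ y, (hA.eigenvalues i : ℂ) *
          ((conj ((hA.eigenvectorBasis i) y) * w y) * conj (conj ((hA.eigenvectorBasis i) x) * w x)) :=
        Finset.sum_congr rfl fun x _ => Finset.sum_comm
    _ = ∑ i, ∑ x, ∑ y, (hA.eigenvalues i : ℂ) *
          ((conj ((hA.eigenvectorBasis i) y) * w y) * conj (conj ((hA.eigenvectorBasis i) x) * w x)) :=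
        Finset.sum_comm
    _ = ∑ i, (hA.eigenvalues i : ℂ) * (((‖∑ x, conj ((hA.eigenvectorBasis i) x) * w x‖ ^ 2 : ℝ)) : ℂ) := by
        refine Finset.sum_congr rfl fun i _ => ?_
        rw [hsq, map_sum, Finset.sum_mul_sum, Finset.mul_sum]
        rw [Finset.sum_comm]
        refine Finset.sum_congr rfl fun x _ => ?_
        rw [Finset.mul_sum]

/-- Consequence for a positive semidefinite matrix: the quadratic form dominates each single eigen-term,
`Re ⟨w, A w⟩ ≥ λ_i |⟨φ_i, w⟩|²`. [folklore] -/
theorem psd_eigen_term_le {A : Matrix N N ℂ} (hA : A.PosSemidef) (w : N → ℂ) (i : N) :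
    hA.1.eigenvalues i * ‖∑ x, conj ((hA.1.eigenvectorBasis i) x) * w x‖ ^ 2 ≤
      (star w ⬝ᵥ (A *ᵥ w)).re := by
  rw [hermitian_quadform_eq_sum hA.1 w, Complex.re_sum]
  have hterm : ∀ j, ((hA.1.eigenvalues j : ℂ) *
      (((‖∑ x, conj ((hA.1.eigenvectorBasis j) x) * w x‖ ^ 2 : ℝ)) : ℂ)).re =
      hA.1.eigenvalues j * ‖∑ x, conj ((hA.1.eigenvectorBasis j) x) * w x‖ ^ 2 := by
    intro j
    rw [← Complex.ofReal_mul, Complex.ofReal_re]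
  simp_rw [hterm]
  refine Finset.single_le_sum (f := fun j => hA.1.eigenvalues j *
      ‖∑ x, conj ((hA.1.eigenvectorBasis j) x) * w x‖ ^ 2) (fun j _ => ?_) (Finset.mem_univ i)
  exact mul_nonneg (hA.eigenvalues_nonneg j) (sq_nonneg _)

/-- The trace of a positive semidefinite matrix is the (real) sum of its eigenvalues. [folklore] -/
theorem psd_re_trace_eq_sum_eigenvalues {A : Matrix N N ℂ} (hA : A.PosSemidef) :
    A.trace.re = ∑ i, hA.1.eigenvalues i := by
  rw [hA.1.trace_eq_sum_eigenvalues, Complex.re_sum]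
  simp

end Bridge

/-! ## Jordan splitting of a Hermitian matrix -/

section Proj

variable {N : Type*}

/-- The rank-one projector `|φ⟩⟨φ|` onto a vector, as a matrix: `(x,y) ↦ φ x · conj(φ y)`. [folklore] -/
def rankOneProj (φ : N → ℂ) : Matrix N N ℂ := Matrix.vecMulVec φ (star φ)

/-- Entries of the rank-one projector. [folklore] -/
theorem rankOneProj_apply (φ : N → ℂ) (x y : N) : rankOneProj φ x y = φ x * conj (φ y) := by
  simp [rankOneProj, Matrix.vecMulVec_apply]

/-- Rank-one projectors are positive semidefinite. [folklore] -/
theorem posSemidef_rankOneProj [Fintype N] (φ : N → ℂ) : (rankOneProj φ).PosSemidef :=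
  Matrix.posSemidef_vecMulVec_self_star φ

/-- The trace of a rank-one projector is the squared norm of the vector. [folklore] -/
theorem trace_rankOneProj [Fintype N] (φ : N → ℂ) : (rankOneProj φ).trace = ∑ x, (((‖φ x‖ ^ 2 : ℝ)) : ℂ) := by
  simp only [Matrix.trace, Matrix.diag_apply, rankOneProj_apply]
  refine Finset.sum_congr rfl fun x _ => ?_
  rw [Complex.mul_conj, Complex.normSq_eq_norm_sq]

/-- A nonnegative real combination of rank-one projectors is positive semidefinite. [folklore] -/
theorem posSemidef_sum_smul_rankOneProj [Fintype N] {ι : Type*} (s : Finset ι) (c : ι → ℝ) (hc : ∀ i, 0 ≤ c i)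
    (φ : ι → N → ℂ) :
    (∑ i ∈ s, ((c i : ℝ) : ℂ) • rankOneProj (φ i)).PosSemidef := by
  refine Matrix.posSemidef_sum s fun i _ => ?_
  exact (posSemidef_rankOneProj (φ i)).smul (Complex.zero_le_real.mpr (hc i))

end Proj

section Jordan

variable {N : Type*} [Fintype N] [DecidableEq N]

/-- **Jordan splitting.** A Hermitian matrix is the difference of two positive semidefinite matrices whose
traces add up to `Σ_i |λ_i|`, namely its positive and negative spectral parts. [folklore] -/
theorem hermitian_exists_jordan {H : Matrix N N ℂ} (hH : H.IsHermitian) :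
    ∃ Y Z : Matrix N N ℂ, Y.PosSemidef ∧ Z.PosSemidef ∧ H = Y - Z ∧
      (Y.trace + Z.trace).re = ∑ i, |hH.eigenvalues i| := by
  set φ := fun i => (⇑(hH.eigenvectorBasis i) : N → ℂ) with hφ
  set lam := hH.eigenvalues with hlam
  refine ⟨∑ i, (((max (lam i) 0 : ℝ)) : ℂ) • rankOneProj (φ i), ∑ i, (((max (-lam i) 0 : ℝ)) : ℂ) • rankOneProj (φ i),
    posSemidef_sum_smul_rankOneProj _ _ (fun i => le_max_right _ _) φ,
    posSemidef_sum_smul_rankOneProj _ _ (fun i => le_max_right _ _) φ, ?_, ?_⟩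
  · ext x y
    rw [hermitian_apply_eq_sum_eigen hH x y, Matrix.sub_apply, Matrix.sum_apply, Matrix.sum_apply,
      ← Finset.sum_sub_distrib]
    refine Finset.sum_congr rfl fun i _ => ?_
    simp only [Matrix.smul_apply, smul_eq_mul, rankOneProj_apply, hφ, hlam]
    have key : ((max (hH.eigenvalues i) 0 : ℝ) : ℂ) - ((max (-hH.eigenvalues i) 0 : ℝ) : ℂ) =
        (hH.eigenvalues i : ℂ) := by
      rcases le_total 0 (hH.eigenvalues i) with h | h
      · rw [max_eq_left h, max_eq_right (by linarith)]; push_cast; ring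
      · rw [max_eq_right h, max_eq_left (by linarith)]; push_cast; ring
    rw [← key]
    ring
  · rw [Matrix.trace_sum, Matrix.trace_sum, ← Finset.sum_add_distrib, Complex.re_sum]
    refine Finset.sum_congr rfl fun i _ => ?_
    rw [Matrix.trace_smul, Matrix.trace_smul, trace_rankOneProj, smul_eq_mul, smul_eq_mul, ← add_mul]
    have hn : (∑ x, (((‖φ i x‖ ^ 2 : ℝ)) : ℂ)) = 1 := by
      have := eigvec_normSq hH i
      exact_mod_cast this
    rw [hn, mul_one, ← Complex.ofReal_add, Complex.ofReal_re]
    rcases le_total 0 (lam i) with h | h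
    · rw [max_eq_left h, max_eq_right (by linarith), add_zero, abs_of_nonneg h]
    · rw [max_eq_right h, max_eq_left (by linarith), zero_add, abs_of_nonpos h]

/-- The sum `Σ_i |λ_i|` as a signed sum of diagonal quadratic forms: `Σ_i |λ_i| = Re Σ_i ε_i ⟨φ_i, H φ_i⟩` with
`ε_i = ±1` the signs of the eigenvalues. [folklore] -/
theorem hermitian_sum_abs_eigenvalues_eq {H : Matrix N N ℂ} (hH : H.IsHermitian) :
    (∑ i, |hH.eigenvalues i|) =
      (∑ i, ((if 0 ≤ hH.eigenvalues i then (1 : ℝ) else -1 : ℝ) : ℂ) *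
        (star (⇑(hH.eigenvectorBasis i) : N → ℂ) ⬝ᵥ (H *ᵥ ⇑(hH.eigenvectorBasis i)))).re := by
  rw [Complex.re_sum]
  refine Finset.sum_congr rfl fun i _ => ?_
  have hq : star (⇑(hH.eigenvectorBasis i) : N → ℂ) ⬝ᵥ (H *ᵥ ⇑(hH.eigenvectorBasis i)) =
      (hH.eigenvalues i : ℂ) := by
    have h1 := eigvec_orthonormal hH i i
    rw [if_pos rfl] at h1
    have hbb : star (⇑(hH.eigenvectorBasis i) : N → ℂ) ⬝ᵥ ⇑(hH.eigenvectorBasis i) = 1 := by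
      rw [← h1, dotProduct]
      refine Finset.sum_congr rfl fun x _ => ?_
      rw [Pi.star_apply, RCLike.star_def]
    rw [hH.mulVec_eigenvectorBasis i, dotProduct_smul, hbb, Complex.real_smul, mul_one]
  rw [hq, ← Complex.ofReal_mul, Complex.ofReal_re]
  split_ifs with h
  · rw [one_mul, abs_of_nonneg h]
  · rw [abs_of_neg (lt_of_not_ge h)]; ring

end Jordan

end Literature.LinearAlgebra.Matrix

end
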